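import Literature.NumberTheory.EllipticCurves.Kato2004.IwasawaCohomologyZetaLiftTwo
import Literature.NumberTheory.EllipticCurves.Kato2004.ZetaLiftEulerSystemClassProofs
import Literature.NumberTheory.EllipticCurves.KatoFineSelmerDual
import HarnessLib

/-!
# Kato 2004 (Astérisque 295) Thm. 13.4 (2) AT `p = 2` — the Euler-system bound for a GENUINE `2`-adic
# Λ-adic Euler-system class of `T₂E`, read on the dual FINE Selmer group `X₀(E/ℚ_∞)`, at the height-one
# primes of `Λ = ℤ₂⟦X⟧` NOT containing `2` — the `p = 2` twin of `Kato2004/EulerSystemBoundFineSelmer.lean`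
# (ONE definition = the `p = 2` spelling of `IsEulerSystemClass`, its two construction lemmas, ONE named fact)

Topic `NumberTheory/EllipticCurves`, sub-directory `Kato2004` (namespace = path). Cell `bsd-wall` (HOME
`run/shared/lean/pub/bsd-wall/`), seat `bsd-wall-tp2-p2x` g0 (LEAD PROVER, line mode, crux K3
stmt-BirchSwinnertonDyer-20308 `SignedKatoDivisibilityUpToAtTwo` of routes `ThetaPartnerAtTwo` /
`ResidualThetaTransportAtTwo`; registered skeleton line `colemanrat` v3, whose stub `stub_katoBoundTwo` is the
fact below VERBATIM after unfolding `IsEulerSystemClassTwo`). HONEST FRAMING (cell bsd-wall): the programme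
assembles the Birch–Swinnerton-Dyer formula for analytic-rank `≤ 1` curves STRICTLY from published theorems and
TYPES the remainder; BSD is not proved by any of this; nothing is booked. THIS FILE: one definition (the `p = 2`
spelling of the sibling predicate `Kato2004.IsEulerSystemClass`), two plumbing theorems showing it is what Kato's
own zeta family produces at `p = 2` (through the tree's `p = 2` lift `IwasawaH1Data.existsUnique_lift_of_zetaBody_two`),
and one named fact (`def … : Prop`, D-0014; nothing asserted, no `_holds`). No instance, no notation, no attribute.

## Why a `p = 2` twin (the gap it fills)

The sibling fact `Kato2004.thm13_4_lengthAt_fineSelmerDual_le_of_isEulerSystemClass` (cell `bsd-potss`) carries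
the binder `p ≠ 2` for ONE reason that is not in Kato's text: its class predicate `IsEulerSystemClass` builds the
layer-`n` component of a Λ-adic class as the corestriction `H¹(ℚ(μ_{p^{n+1}}), T) → H¹(ℚ_n, T)`, and at `p = 2`
the `n`-th layer `ℚ_n = ℚ(ζ_{2^{n+2}})⁺` of the cyclotomic `ℤ₂`-extension is NOT contained in `ℚ(μ_{2^{n+1}})`
(`ℚ₁ = ℚ(√2) ⊄ ℚ(i)`), so that predicate is EMPTY of Kato's classes at `2`. The tree already holds the `p = 2`
corestriction `Kato2004.levelToLayerTwo` (`H¹(ℚ(μ_{2^{n+2}}), T₂W) → H¹(ℚ_n, T₂W)`, file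
`IwasawaCohomologyZetaLiftTwo`, cell `bsd-2adic`) and the `p = 2` zeta lift; this file supplies the matching
predicate and Kato's bound in that spelling. PRINT HAS NO PARITY HYPOTHESIS HERE: §13 opens with "In this
section, we fix a prime number `p`" [p. 224], Thm. 13.4 (1)(2) are stated for that `p` and only (3) adds "Assume
further `p ≠ 2`" [p. 226]; Thm. 12.5 (3) [p. 222] (the bound for Kato's own `Z(f)`) is for «a prime ideal of `Λ`
of height one which does not contain `p`», any `p`; and the main conjecture itself is formulated at `p = 2`
exactly at these primes: Conj. 12.10 [p. 224] "In the case `p = 2`, assume `𝔭` does not contain `2`."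
Consumer (kernel, Summits-side, this seat): `Theorems/ThetaPartnerAtTwoSignedKatoUpToAtTwoOffTwoRoad.lean`
(`offTwo_of_colemanLengthTwo_of_katoBoundTwo`: with the `2`-adic Coleman/Poitou–Tate length inequality it gives
K3 = Kobayashi's Thm. 1.3 (i) at `p = 2`, «`char X⁺(E/ℚ_∞) ⊇ (L♭)` in `Λ ⊗ ℚ₂`», file `…OffTwo.lean`).

## Source, verbatim (K. Kato, *p-adic Hodge theory and values of zeta functions of modular forms*,
## Astérisque 295 (2004) 117–290 [Kato2004Asterisque]; held copy `paper:url-37fbba0bb64a`, PDF page = printed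
## page − 115, read by this seat 2026-08-27, pp. 220–228; the sibling file quotes §12.2, §13.1, Ex. 13.3, Thm.
## 13.4, Prop. 13.7 in full — repeated here only where `p = 2` matters)

§13 (p. 224): "In this section, we give the proof of the theorems in §12 by using the method of Euler systems in
the case `f` has no CM. […] In this section, we fix a prime number `p`." §13.1 (pp. 224–225): "Let `L` be a
finite extension of `ℚ_p` and let `T` be a free `O_L`-module of finite rank endowed with a continuous `O_L`-linear
action of `Gal(ℚ̄/ℚ)` which is unramified at almost all prime numbers. Let `Σ` be a finite set of prime numbers
containing `p` and all prime numbers at which the action of `Gal(ℚ̄/ℚ)` on `T` ramifies […] By an Euler system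
for `(T, L, Σ)`, we mean a system of elements `z_m ∈ H¹(ℤ[ζ_m, 1/p], T)` defined for `m ∈ Ξ`, satisfying
[(13.1.1), the norm relations]." **Thm. 13.4** (p. 226): "Let `(T, L, Σ)` be as in 13.1, and let `(z_m)_m` be an
Euler system for `(T, L, Σ)`. Let `Λ = O_L[[G_∞]]`, let `Z` be the `Λ`-submodule of `𝐇¹(T)` generated by
`(z_{p^n})_n`, and let `J` be the ideal of `Λ` generated by `h(Z)` for all `Λ`-homomorphisms `h : 𝐇¹(T) → Λ`.
On the other hand, let `𝐇²(T)₀ = Ker(𝐇²(T) → 𝐇²_loc(T))`. Assume the following (i)–(v). (i) `Z_q ≠ 0` for any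
prime ideal `q` of `Λ` of height `0`. (ii) `rank_{O_L}(T⁺) = rank_{O_L}(T⁻) = 1`. (iii) [Weil numbers] (iv)
`T ⊗_{O_L} L` is irreducible […] (v) There exists an element `σ` of `Gal(ℚ̄/ℚ(ζ_{p^∞}))` such that
`dim_L(Coker(1 − σ ; T ⊗_{O_L} L → T ⊗_{O_L} L)) = 1`. Then we have: (1) `𝐇²(T)` is a torsion `Λ`-module. (2)
Let `𝔭` be a prime ideal of `Λ` of height one which does not contain `p`. Then
`length_{Λ_𝔭}(𝐇²(T)_{0,𝔭}) ≤ length_{Λ_𝔭}(Λ_𝔭/J_𝔭)`. (3) […] Assume further `p ≠ 2`. Then […] for any prime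
ideal `𝔭` of `Λ` of height one. In the case of 13.3, the conditions (ii), (iii), (iv) in Thm. 13.4 are satisfied
[…] However if `f` has CM, this theorem is not applied because the condition (v) is not satisfied in the CM
case." **Prop. 13.7** (p. 227): "Define `Z ⊂ 𝐇¹(V_{O_λ}(f))` as in Thm. 12.6. Then `Z_q ≠ 0` for any prime ideal
`q` of `Λ` of height `0`." **Thm. 12.5 (3)** (p. 222): "Let `𝔭` be a prime ideal of `Λ` of height one which does
not contain `p`. Then `length_{Λ_𝔭}(𝐇²(V_{F_λ}(f))_𝔭) ≤ length_{Λ_𝔭}(𝐇¹(V_{F_λ}(f))_𝔭/Z(f)_𝔭) +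
length_{Λ_𝔭}(𝐇²_loc(V_{F_λ}(f))_𝔭)`" (and `𝐇²_loc(V)_𝔭 ≠ 0` only under (12.5.1): `f` not potentially good at
`p`); **Thm. 12.5 (4)** is the clause with "Assume `p ≠ 2`". **Conj. 12.10** (p. 224): "Let `T` be a
`Gal(ℚ̄/ℚ)`-stable `O_λ`-lattice of `V_{F_λ}(f)` and let `𝔭` be a prime ideal of `Λ` of height one. In the case
`p = 2`, assume `𝔭` does not contain `2`. Then `Z(f,T)_𝔭 ⊂ 𝐇¹(T)_𝔭` and `length_{Λ_𝔭}(𝐇²(T)_𝔭) =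
length_{Λ_𝔭}(𝐇¹(T)_𝔭/Z(f,T)_𝔭)`." §12.1 (p. 219): `G_∞ = Gal(ℚ(ζ_{p^∞})/ℚ) ≅ ℤ_p^×`; for `p ≠ 2`,
`G_∞ ≅ Δ × G¹_∞` and (12.1.2) `O_L[[G_∞]] ≅ ∏_j O_L[[T]]` — at `p = 2`, `ℤ₂^× = {±1} × (1 + 4ℤ₂)`, `Δ = {±1}` has
order `2 = p` and `ℤ₂[[G_∞]] = ℤ₂⟦T⟧[Δ]` is NOT a product of copies of `ℤ₂⟦T⟧`.
L. C. Washington, *Introduction to Cyclotomic Fields* §13.1 [Washington1997]: the cyclotomic `ℤ₂`-extension of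
`ℚ` has layers `ℚ_n = ℚ(ζ_{2^{n+2}})⁺ = ℚ(ζ_{2^{n+2}} + ζ_{2^{n+2}}⁻¹)`, `ℚ₁ = ℚ(√2)`; `ℚ(ζ_{2^{n+2}}) = ℚ_n(i)`.
F. Sprung, J. Number Theory 132 (2012) [Sprung2012], p. 1487: "Let `N = n + 1` if `p` is odd, and `N = n + 2`
if `p = 2`. Put `k_n = ℚ_p(ζ_{p^N})`"; Def. 6.1 (p. 1495): "If `p = 2`, we have `z^± = (z_n^±)_n ∈
H¹_Iw(T) ⊗ ℚ`" — Kato's zeta elements along the `μ_{2^{n+2}}`-tower at `p = 2`.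

## Transcription — the definition, the binders, the ONE clause, and the reading flags (for the referee)

* `IsEulerSystemClassTwo W hκ I s` — VERBATIM the sibling `IsEulerSystemClass W p κ γ I s` at `p = 2` with the
  single change forced by the tower: the layer-`n` component of `s` is `Cor_{ℚ(μ_{2^{n+2}})/ℚ_n}(z_{n+2,∅})`
  (the tree's `levelToLayerTwo W hκ S n`, along `ZpExtension.IsCyclotomic.cyclotomicLevelsRat_level_le_layerSubgroup_two`)
  instead of `Cor_{ℚ(μ_{p^{n+1}})/ℚ_n}(z_{n+1,∅})`. As there: a FINITE bad set `S`, an Euler system `z` for `T₂W`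
  over `cyclotomicLevelsRat 2 S` (Rubin Def. 2.1.1 = tree `IsEulerSystem`; Kato (13.1.1) on the squarefree-tame
  sub-family, flag `Kato-134-levels` of the sibling), ALL classes integral (`integralH1`: Kato's
  `z_m ∈ H¹(ℤ[ζ_m, 1/p], T)`). `isEulerSystemClassTwo_of_zetaBody` / `exists_isEulerSystemClassTwo_of_zetaBody`:
  Kato's own `(c, d, a(A))`-family at `p = 2` (a `ZetaBody W 2 …` witness; the existence facts
  `exists_eulerSystem_expStar_values` / `exists_member_eulerSystem_expStar_values` carry NO parity hypothesis)
  produces such classes — the `p = 2` twins of `isEulerSystemClass_of_zetaBody` / `exists_isEulerSystemClass_of_zetaBody`.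
* The fact: binders `W/ℚ` ANY elliptic curve (any reduction at `2`; structure facts of `T₂W` as instance BINDERS,
  convention of `EulerSystemValues.tateRep`), NOT CM (this implies hypothesis (v) for `T₂W` at every `p`: tree
  theorem `Kato2004.exists_finrank_coker_eq_one_of_not_hasCM`, Serre's open image — so (v) is DISCHARGED rather
  than displayed; Kato: "(v) is not satisfied in the CM case"), the cyclotomic `ℤ₂`-extension `κ`
  (`hκ : κ.IsCyclotomic`, needed to write the corestriction) with topological generator `γ`, the pinned
  `I : IwasawaH1Data W 2 κ γ` (`𝐇¹_Γ(T₂W) = lim←_n H¹(ℤ_n[1/2], T₂W)`) and `FB : W.FineSelmerDualData κ γ`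
  (`X₀(W/ℚ_∞)`), a class `s` with `IsEulerSystemClassTwo W hκ I s` and `s ≠ 0`. Conclusion = clause (2) ONLY:
  at every height-one `𝔭` of `Λ = ℤ₂⟦X⟧` with `2 ∉ 𝔭`, `ℓ_𝔭(X₀(W/ℚ_∞)) ≤ ℓ_𝔭(𝐇¹_Γ(T₂W)/Λs)`. Clause (3)
  ("Assume further `p ≠ 2`") and Thm. 12.5 (4) are NOT transcribed; nothing is said at `𝔭 = (2)`.
READING FLAGS. `Kato-134-two-Delta` (the only new one): Kato's `Λ_K = ℤ₂[[G_∞]] = Λ[Δ]`, `Δ = Gal(ℚ(μ_{2^∞})/ℚ_∞)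
= {1, c}` of order `2`, has no idempotents `e_±`; but at a height-one prime `𝔭 ∌ 2` of `Λ` the localisation
`Λ_K ⊗_Λ Λ_𝔭 = Λ_𝔭[Δ] = Λ_𝔭e₊ × Λ_𝔭e₋` splits (`2 ∈ Λ_𝔭ˣ`), the height-one primes of `Λ_K` over `𝔭` not
containing `2` are `𝔔_± = (𝔭, c ∓ 1)`, and for every `Λ_K`-module `M`, `M_{𝔔₊} = (M_Δ)_𝔭 = (M^Δ)_𝔭`. Along
`K_n = ℚ(ζ_{2^{n+2}}) = ℚ_n(i)`, restriction and corestriction between `H¹(ℤ_n[1/2], ·)` and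
`H¹(ℤ[ζ_{2^{n+2}}, 1/2], ·)^{Δ}` / `(·)_Δ` compose to `2` and to `1 + c`, so they are isomorphisms after `⊗ Λ_𝔭`;
hence `𝐇¹(T)_{𝔔₊} ≅ 𝐇¹_Γ(T₂W)_𝔭` with Kato's generator `(z_{2^{n+2}})_n` of `Z` mapping to the class `s` of this
file (its layer components ARE the corestrictions), `(Λ_K/J)_{𝔔₊} ≅ (𝐇¹_Γ/Λs)_𝔭` (`𝐇¹` torsion free of rank
one: Thm. 12.4 (2), tree `IwasawaH1Data.isTorsionFree`; flag `Kato-134-J-quotient` of the sibling), and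
`𝐇²(T)_{0,𝔔₊} ≅ X₀(W/ℚ_∞)_𝔭` (flag `Kato-134-H20-fine` of the sibling: Poitou–Tate along `ℚ(μ_{2^∞})`, whose
places over `ℓ ≠ 2` have residue fields containing `μ_{2^∞}`; then `Sel₀(ℚ_n) → Sel₀(K_n)^Δ` has kernel and
cokernel killed by `2`). So clause (2) at `𝔔₊` IS the displayed inequality at `𝔭`; no statement at `𝔭 ∋ 2` is
made, which is where the missing idempotents would matter. `Kato-134-i-two`: hypothesis (i) asks `Z_q ≠ 0` at
BOTH height-`0` primes `q_± = (c ∓ 1)` of `Λ_K`; `s ≠ 0` is the `q₊`-half; if the `q₋`-half fails for the given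
system `z`, replace `z` by the INTEGRAL Euler system `2z + a(1 − c̃)ζ` (`a ∈ {1, 2}`, `c̃ ∈ Gal(ℚ̄/ℚ)` a complex
conjugation acting on every level by transport of structure — (13.1.1) is `O_L[Gal]`-linear —, `ζ` Kato's system
of Ex. 13.3 for `T₂W`, both of whose `Δ`-components are non-zero by Prop. 13.7): its `q₊`-component is that of
`2z`, so the class seen at `𝔔₊` is `2s`, the same as `s` after `⊗ Λ_𝔭`. (ii)–(iv) hold in print for `T₂W`
(Ex. 13.3, 14.10). Everything recorded is implied by, never stronger than, the print; flags `Kato-134-levels`,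
`Kato-134-H20-fine`, `Kato-134-J-quotient` of the sibling apply verbatim.

## What is NOT here (and why)

* NO clause (3) / Thm. 12.5 (4) (both printed with `p ≠ 2`), nothing at the prime `(2)` of `Λ` (no `μ`-statement):
  at `p = 2` Kato formulates even the main conjecture only off `2` (Conj. 12.10).
* NO Coleman map, no `p`-adic `L`-function, no identification of `s` with a zeta VALUE: the signed/♭ Coleman side
  at `p = 2` (Kobayashi (7.21), Thm. 6.3; Sprung 2012 §7, printed for `p` odd) is the research content of the
  consumer's other stub and is not a Literature fact.
* NO `_holds` (Kato §13 = [Pe4], [Ru4], [KK4]: the Euler-system machinery is not in Mathlib; size XL).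

## READING NOTE (added 2026-08-28, doc-only; the declarations of this file are UNCHANGED)

`Kato-134-dual-action`: the fact below pins the dual fine Selmer group as `FB : W.FineSelmerDualData κ γ`,
whose `T` acts on `Hom(Sel₀(ℚ_∞, E[2^∞]), ℚ/ℤ)` by PRE-composition with `conj_γ`
(`FineSelmerDualData.toDual_T_smul`), while `I : IwasawaH1Data W 2 κ γ` carries Kato's natural
(covariant) action `T = conj_γ − 1` (`IwasawaH1Data.proj_T_smul`). Poitou–Tate duality, being functorial
(transport of structure), carries the natural action on `𝐇²(T)₀` to the CONTRAGREDIENT action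
`x ↦ x ∘ conj_{γ⁻¹}` on the Pontryagin dual, so with `1 + T ↦ γ` on both sides Kato's `𝐇²(T)₀` is the datum
`W.FineSelmerDualData κ γ⁻¹`, and the inequality below reads `ℓ_{ι𝔭}(X₀) ≤ ℓ_𝔭(𝐇¹/Λs)` (`ι(γ) = γ⁻¹`,
Greenberg's `S^ι` [Greenberg1989, pp. 101–102]) — Kato's Thm. 13.4 (2) composed with `ι` on ONE side; it
coincides with the print only granted the unprinted statement «`char_Λ(𝐇¹(T₂W)/Λs)` is `ι`-symmetric
prime by prime» (convention audit of the consumer cell `bsd-wall`, crux `SignedKatoDivisibilityUpToAtTwo`,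
`G4-CONVENTION-AUDIT.md` + second reader, 2026-08-28). The PRINT-EXACT reading (same `𝔭` on both sides,
`FB` over `γ⁻¹`) is the sibling named fact
`Kato2004.thm13_4_two_lengthAt_fineSelmerDualContra_le_of_isEulerSystemClassTwo`
(file `Kato2004/EulerSystemBoundFineSelmerTwoContragredient.lean`, whose module docstring carries the
derivation and the verbatim sources); the `ι𝔭`-spelling is kernel-equivalent to it (consumer cell's
`…KatoBoundTwist.lean`). This fact is kept VERBATIM (D-0014: a fact's meaning is never changed in place;
existing consumers are untouched).

References: [Kato2004Asterisque] §12.1 (p. 219), §12.2 (p. 220), Thm. 12.4 (2) (p. 221), Thm. 12.5 (3)(4),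
Thm. 12.6 (p. 222), Conj. 12.10 (p. 224), §13.1 (13.1.1), Ex. 13.3 (pp. 224–225), Thm. 13.4 (p. 226), Prop. 13.7
(p. 227), §13.8 (p. 228), 14.10 (p. 241); [Washington1997] §13.1; [Sprung2012] p. 1487, Def. 6.1 (p. 1495);
[Rubin2000] Def. 2.1.1, Remark 2.1.4; [Greenberg1989] §0 pp. 101–102; tree: `Kato2004/{EulerSystemBoundFineSelmer,
EulerSystemClasses, IwasawaCohomologyZetaLiftTwo, ZetaLiftEulerSystemClassProofs, ConditionVOfNotHasCMProofs,
EulerSystemBoundFineSelmerTwoContragredient}.lean`, `CyclotomicZpExtensionLayerTwoProofs.lean`, `KatoFineSelmerDual.lean`.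
-/

noncomputable section

open scoped NumberField TensorProduct
open Field IsDedekindDomain
open Literature.NumberTheory.GaloisRepresentations
open Literature.NumberTheory.EllipticCurves Literature.NumberTheory.EllipticCurves.Kato2004.EulerSystemValues
  Rat.HeightOneSpectrum

namespace Literature.NumberTheory.EllipticCurves.Kato2004

/-! ## §1 The `p = 2` spelling of "genuine Λ-adic Euler-system class" -/

section Vocabulary

variable (W : WeierstrassCurve ℚ) [W.IsElliptic] [ContinuousSMul ℤ_[2] (W.tateModule 2)]
  [Module.Free ℤ_[2] (W.tateModule 2)] [Module.Finite ℤ_[2] (W.tateModule 2)]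
  {κ : ZpExtension ℚ 2} (hκ : κ.IsCyclotomic) {γ : absoluteGaloisGroup ℚ}

/-- **`s ∈ 𝐇¹_Γ(T₂W)` is the Λ-adic class of a GENUINE integral Euler system for `T₂W` (`p = 2`).**  There are
a FINITE set `S` of bad places, an Euler system `z = (z_{k,r})` for `T₂W` over the cyclotomic levels
`ℚ(μ_{2^k})·∏_{q∈r}ℚ(μ_q)` away from `S` (Rubin Def. 2.1.1 = tree `IsEulerSystem`; Kato (13.1.1), Ex. 13.3),
all of whose classes are integral (tree `integralH1`; Kato (8.1.3), §8.2/Lemma 8.5), such that for every `n` the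
`n`-th layer component of `s` is the corestriction to `ℚ_n = ℚ(ζ_{2^{n+2}})⁺` of the level-`ℚ(μ_{2^{n+2}})`
class `z_{n+2,∅}` (tree `levelToLayerTwo`; Kato §13.8, Thm. 13.4 "`Z` … generated by `(z_{p^n})_n`"). The
`p = 2` twin of `IsEulerSystemClass` (level index `n + 2` instead of `n + 1`: `ℚ_n ⊂ ℚ(μ_{2^{n+2}})`,
Washington §13.1). [cite: Kato2004Asterisque, §13.1 (13.1.1), Ex. 13.3 (pp. 224–225), Thm. 13.4 (p. 226), (8.1.3), §8.2 and Lemma 8.5 (pp. 180–184), §13.8 (p. 228)]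
[cite: Rubin2000, Def. 2.1.1 and Remark 2.1.4] [cite: Washington1997, §13.1] -/
def IsEulerSystemClassTwo (I : IwasawaH1Data W 2 κ γ) (s : I.H) : Prop :=
  ∃ (S : Set (HeightOneSpectrum (𝓞 ℚ))) (_ : S.Finite)
    (z : ∀ (k : ℕ) (r : (cyclotomicLevelsRat 2 S).Ideals),
      H1 (tateRep W 2) ((cyclotomicLevelsRat 2 S).level k r.1)),
    IsEulerSystem (cyclotomicLevelsRat 2 S) (tateRep W 2) 2 z ∧
    (∀ (k : ℕ) (r : (cyclotomicLevelsRat 2 S).Ideals),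
      z k r ∈ integralH1 (tateRep W 2) 2 ((cyclotomicLevelsRat 2 S).level k r.1)) ∧
    ∀ n : ℕ, I.proj n s = levelToLayerTwo W hκ S n (z (n + 2) (cyclotomicLevelsRat 2 S).idealOne)

variable (I : IwasawaH1Data W 2 κ γ)

/-- Unfolding `IsEulerSystemClassTwo`. [cite: Kato2004Asterisque, §13.1 and Thm. 13.4 (pp. 224–226)] -/
theorem isEulerSystemClassTwo_iff (s : I.H) :
    IsEulerSystemClassTwo W hκ I s ↔
      ∃ (S : Set (HeightOneSpectrum (𝓞 ℚ))) (_ : S.Finite)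
        (z : ∀ (k : ℕ) (r : (cyclotomicLevelsRat 2 S).Ideals),
          H1 (tateRep W 2) ((cyclotomicLevelsRat 2 S).level k r.1)),
        IsEulerSystem (cyclotomicLevelsRat 2 S) (tateRep W 2) 2 z ∧
        (∀ (k : ℕ) (r : (cyclotomicLevelsRat 2 S).Ideals),
          z k r ∈ integralH1 (tateRep W 2) 2 ((cyclotomicLevelsRat 2 S).level k r.1)) ∧
        ∀ n : ℕ, I.proj n s = levelToLayerTwo W hκ S n (z (n + 2) (cyclotomicLevelsRat 2 S).idealOne) :=
  Iff.rfl

/-- **The Λ-adic lift of the `2`-power line of an INTEGRAL Euler system is a genuine `2`-adic Euler-system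
class**: if `z` is an Euler system for `T₂W` over the cyclotomic levels away from a finite `S`, all classes
integral, and `y ∈ 𝐇¹_Γ(T₂W)` has `proj n y = Cor_{ℚ(μ_{2^{n+2}})/ℚ_n}(z_{n+2,∅})` for every `n`, then
`IsEulerSystemClassTwo W hκ I y`. [cite: Kato2004Asterisque, §13.1 (13.1.1), Thm. 13.4 (p. 226) and §13.8 (p. 228)]
[cite: Rubin2000, Def. 2.1.1] -/
theorem isEulerSystemClassTwo_of_proj_eq_levelToLayerTwo {S : Set (HeightOneSpectrum (𝓞 ℚ))} (hS : S.Finite)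
    {z : ∀ (k : ℕ) (r : (cyclotomicLevelsRat 2 S).Ideals), H1 (tateRep W 2) ((cyclotomicLevelsRat 2 S).level k r.1)}
    (hz : IsEulerSystem (cyclotomicLevelsRat 2 S) (tateRep W 2) 2 z)
    (hint : ∀ (k : ℕ) (r : (cyclotomicLevelsRat 2 S).Ideals),
      z k r ∈ integralH1 (tateRep W 2) 2 ((cyclotomicLevelsRat 2 S).level k r.1))
    {y : I.H}
    (hy : ∀ n : ℕ, I.proj n y = levelToLayerTwo W hκ S n (z (n + 2) (cyclotomicLevelsRat 2 S).idealOne)) :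
    IsEulerSystemClassTwo W hκ I y :=
  ⟨S, hS, z, hz, hint, hy⟩

/-- **Kato's `(c, d, a(A))`-zeta family lifts to a genuine `2`-adic Euler-system class.**  For a
`ZetaBody W 2 …` witness `(κ', Λ', z, x)` (Kato's Euler system for `T₂W` with its values, (8.1.3)/Ex. 13.3;
the existence facts carry no parity hypothesis) with `2cdAN ≠ 0`, any `y ∈ 𝐇¹_Γ(T₂W)` with
`proj n y = Cor_{ℚ(μ_{2^{n+2}})/ℚ_n}(z_{n+2,∅})` for all `n` — in particular THE lift of
`IwasawaH1Data.existsUnique_lift_of_zetaBody_two` — satisfies `IsEulerSystemClassTwo W hκ I y`: (C1) is the Euler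
system, (C2) the integrality of every class. The `p = 2` twin of `isEulerSystemClass_of_zetaBody`.
[cite: Kato2004Asterisque, Ex. 13.3 (p. 225), (8.1.3) and Lemma 8.5 (pp. 180–184), Thm. 13.4 (p. 226)]
[cite: Sprung2012, Def. 6.1 (p. 1495)] -/
theorem isEulerSystemClassTwo_of_zetaBody {N : ℕ} {f : CuspForm (CongruenceSubgroup.Gamma0 N) 2}
    {ι : (m : ℕ) → (CyclotomicField m ℚ →+* ℂ)} {κ' : ℝ}
    {Λ' : ∀ (k : ℕ) (r : Finset (HeightOneSpectrum (𝓞 ℚ))),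
      H1 (tateRep W 2) (cycSubgroup 2 k r) →ₗ[ℤ_[2]] ℚ_[2] ⊗[ℚ] CyclotomicField (cycLevel 2 k r) ℚ}
    {c d a : ℤ} {A : ℕ}
    {z : ∀ (k : ℕ) (r : (cyclotomicLevelsRat 2 (badPlaces c d A N)).Ideals),
      H1 (tateRep W 2) ((cyclotomicLevelsRat 2 (badPlaces c d A N)).level k r.1)}
    {x : ∀ (k : ℕ) (r : (cyclotomicLevelsRat 2 (badPlaces c d A N)).Ideals),
      CyclotomicField (cycLevel 2 k r.1) ℚ}
    (hbody : ZetaBody W 2 f ι κ' Λ' c d a A z x) (hne : 2 * c.natAbs * d.natAbs * A * N ≠ 0)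
    {y : I.H} (hy : ∀ n : ℕ, I.proj n y = levelToLayerTwo W hκ (badPlaces c d A N) n
      (z (n + 2) (cyclotomicLevelsRat 2 (badPlaces c d A N)).idealOne)) :
    IsEulerSystemClassTwo W hκ I y :=
  isEulerSystemClassTwo_of_proj_eq_levelToLayerTwo W hκ I (badPlaces_finite hne) hbody.1
    (fun k r v hv 𝔓 h𝔓 ↦ hbody.2.1 k r v hv 𝔓 h𝔓) hy

/-- **Existence form**: at `p = 2` every `ZetaBody` family with `2cdAN ≠ 0` has a (unique) Λ-adic lift
(`IwasawaH1Data.existsUnique_lift_of_zetaBody_two`), and that lift is a genuine `2`-adic Euler-system class.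
The `p = 2` twin of `exists_isEulerSystemClass_of_zetaBody`.
[cite: Kato2004Asterisque, §13.1 and Thm. 13.4 (pp. 224–226), Ex. 13.3 (p. 225)] [cite: Sprung2012, Def. 6.1 (p. 1495)] -/
theorem exists_isEulerSystemClassTwo_of_zetaBody {N : ℕ} (f : CuspForm (CongruenceSubgroup.Gamma0 N) 2)
    (ι : (m : ℕ) → (CyclotomicField m ℚ →+* ℂ)) (κ' : ℝ)
    (Λ' : ∀ (k : ℕ) (r : Finset (HeightOneSpectrum (𝓞 ℚ))),
      H1 (tateRep W 2) (cycSubgroup 2 k r) →ₗ[ℤ_[2]] ℚ_[2] ⊗[ℚ] CyclotomicField (cycLevel 2 k r) ℚ)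
    (c d a : ℤ) (A : ℕ)
    (z : ∀ (k : ℕ) (r : (cyclotomicLevelsRat 2 (badPlaces c d A N)).Ideals),
      H1 (tateRep W 2) ((cyclotomicLevelsRat 2 (badPlaces c d A N)).level k r.1))
    (x : ∀ (k : ℕ) (r : (cyclotomicLevelsRat 2 (badPlaces c d A N)).Ideals),
      CyclotomicField (cycLevel 2 k r.1) ℚ)
    (hbody : ZetaBody W 2 f ι κ' Λ' c d a A z x) (hne : 2 * c.natAbs * d.natAbs * A * N ≠ 0) :
    ∃ y : I.H, IsEulerSystemClassTwo W hκ I y ∧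
      ∀ n : ℕ, I.proj n y = levelToLayerTwo W hκ (badPlaces c d A N) n
        (z (n + 2) (cyclotomicLevelsRat 2 (badPlaces c d A N)).idealOne) := by
  obtain ⟨y, hy, -⟩ := IwasawaH1Data.existsUnique_lift_of_zetaBody_two W hκ I f ι κ' Λ' c d a A z x hbody
  exact ⟨y, isEulerSystemClassTwo_of_zetaBody W hκ I hbody hne hy, hy⟩

end Vocabulary

/-! ## §2 The named fact: Thm. 13.4 (2) for `T = T₂W` at `p = 2`, on the pinned `(𝐇¹_Γ(T₂W), X₀(W/ℚ_∞))` -/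

/-- **Kato 2004, Thm. 13.4 (2) at `p = 2` for `T = T₂W` (Ex. 13.3 with `k = 2`, `r = 1`), read on the dual fine
Selmer group over the cyclotomic `ℤ₂`-extension.** For every elliptic curve `W/ℚ` WITHOUT complex multiplication
(this gives Kato's hypothesis (v) for `T₂W`: `Kato2004.exists_finrank_coker_eq_one_of_not_hasCM`; (ii)–(iv) hold
in print; ANY reduction at `2`; structure facts of `T₂W` as instance BINDERS), the cyclotomic `ℤ₂`-extension `κ`
with topological generator `γ`, every pinned `I : IwasawaH1Data W 2 κ γ` (`𝐇¹_Γ(T₂W)`) and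
`FB : W.FineSelmerDualData κ γ` (`X₀(W/ℚ_∞)`), and every GENUINE `2`-adic Λ-adic Euler-system class
`s ∈ 𝐇¹_Γ(T₂W)` (`IsEulerSystemClassTwo`: layer components `Cor_{ℚ(μ_{2^{n+2}})/ℚ_n}(z_{n+2,∅})` of an integral
Euler system `z`) with `s ≠ 0` (hypothesis (i), flag `Kato-134-i-two`): at every height-one prime `𝔭` of
`Λ = ℤ₂⟦X⟧` with `2 ∉ 𝔭`, `ℓ_𝔭(X₀(W/ℚ_∞)) ≤ ℓ_𝔭(𝐇¹_Γ(T₂W)/Λs)` ("`length_{Λ_𝔭}(𝐇²(T)_{0,𝔭}) ≤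
length_{Λ_𝔭}(Λ_𝔭/J_𝔭)`" at the prime `𝔔₊ = (𝔭, c − 1)` of `ℤ₂[[G_∞]]`, flags `Kato-134-two-Delta`,
`Kato-134-H20-fine`, `Kato-134-J-quotient`). Length form = print (a non-torsion quotient has local length `⊤`, so
no junk). ONLY clause (2): clause (3) and Thm. 12.5 (4) are printed with `p ≠ 2` and are not transcribed; this is
the set of primes at which Kato states Conj. 12.10 for `p = 2`. Named fact; nothing asserted; weaker than print
(module docstring); no `_holds` (Kato §13: size XL). The `p = 2` twin of
`thm13_4_lengthAt_fineSelmerDual_le_of_isEulerSystemClass` (whose `p ≠ 2` is the `μ_{p^{n+1}}`-indexing of its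
class predicate, not a hypothesis of Thm. 13.4 (2)).
-- TODO(general form): Kato's Thm. 13.4 (2) at `p = 2` for an arbitrary lattice `T` as in 13.1 over the full
-- `Λ = O_L[[G_∞]]` (both `Δ`-components), a not necessarily cyclic `Z`, and CM forms via §15; here only `T = T₂W`,
-- `W` non-CM, the `Δ`-trivial (`ℚ_∞`) component at the primes `∌ 2`, and `Z = Λs`.
[cite: Kato2004Asterisque, Thm. 13.4 (2) (p. 226), §13.1 (13.1.1) and Ex. 13.3 (pp. 224–225), Prop. 13.7 (p. 227), Thm. 12.5 (3) (p. 222), Conj. 12.10 (p. 224), §12.1 (p. 219), §12.2 (p. 220), Thm. 12.4 (2) (p. 221)]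
[cite: Washington1997, §13.1] [cite: Rubin2000, Def. 2.1.1 and Remark 2.1.4] -/
def thm13_4_two_lengthAt_fineSelmerDual_le_of_isEulerSystemClassTwo : Prop :=
  ∀ (W : WeierstrassCurve ℚ) [W.IsElliptic], ¬ W.HasCM →
    ∀ [ContinuousSMul ℤ_[2] (W.tateModule 2)] [Module.Free ℤ_[2] (W.tateModule 2)]
      [Module.Finite ℤ_[2] (W.tateModule 2)]
      (κ : ZpExtension ℚ 2) (γ : absoluteGaloisGroup ℚ) (hκ : κ.IsCyclotomic), κ.IsTopGenerator γ →
    ∀ (I : IwasawaH1Data W 2 κ γ) (FB : W.FineSelmerDualData κ γ) (s : I.H),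
      IsEulerSystemClassTwo W hκ I s → s ≠ 0 →
      ∀ 𝔭 : PrimeSpectrum (IwasawaAlgebra 2), 𝔭.asIdeal.height = 1 →
        PowerSeries.C (2 : ℤ_[2]) ∉ 𝔭.asIdeal →
          Module.lengthAt (IwasawaAlgebra 2) FB.X 𝔭 ≤
            Module.lengthAt (IwasawaAlgebra 2) (I.H ⧸ Submodule.span (IwasawaAlgebra 2) {s}) 𝔭

end Literature.NumberTheory.EllipticCurves.Kato2004

end
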